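import Summits.Ventures.HSemireg.WedgeHankelRecurrenceExtension
import Summits.Ventures.HSemireg.WedgeHankelRecurrenceLevel
import Summits.Ventures.HSemireg.WedgeHankelRecurrenceLinearComplexity

/-!
# Venture HSemireg — KRONECKER'S THEOREM FOR AN INFINITE SEQUENCE (1881): for `q : ℕ → K` and `d : ℕ` the following are equivalent — (i) `q` is a DUAL CLASS `dualSeq m a` with `m` monic of
# degree `≤ d` (the coefficient sequence of a rational function `a/m`, `deg a < deg m ≤ d`); (ii) ALL THE MIDDLE HANKEL RANKS ARE BOUNDED: `R^N(q) ≤ d` for every `N`; (iii) `q` satisfies ONE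
# monic linear recurrence of order `≤ d` at every shift.  Moreover the eventual value of the non-decreasing sequence `R^N(q)` is the degree of the minimal recurrence
# («a sequence is linearly recurrent iff its infinite Hankel matrix has finite rank, and the rank is the order of the minimal recurrence»)

HONEST FRAMING. Part of the Lean index of the computation cell `pub-hsemireg` (seat p10 gen 31, Sunday typer «UNIFORM-IN-n»).
PRIOR ART IN THE TREE (not restated, not imported here): the infinite-matrix form of Kronecker's theorem over the Hankel SECTIONS `(a_{m+i+j})` is PROVED in
`Literature/LinearAlgebra/Matrix/HankelRecurrenceRank.lean` (Gantmacher, *Theory of Matrices* II, Ch. XV §10 Thm. 7: `isLinRec_iff_exists_rank_hankel_le`, `rank_hankel_eq_natDegree_minpolySeq`)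
for the Literature's notion `IsLinRec` ∕ `minpolySeq` (`WiedemannAlgorithm.lean`); THIS file is the lineage's WINDOW form — middle ranks `R^N(q)` of N18's catalecticant, dual classes of N32,
the persistence lemma through N40/N41's transition rules — and the identification of the two languages (`hkFun = polySMul`, `R^N` bounded `⟺ IsLinRec`, eventual `R^N = deg minpolySeq`) is the
separate bridge file `WedgeHankelRecurrenceLinRecBridge`.
LINEAR ALGEBRA OF HANKEL (catalecticant) MATRICES and of polynomials over a field ONLY: no variety, no cohomology theory, no sheaf, no Ext group and no semiregularity map is constructed
here; nothing here says that HC / HC_CM / HC_AV holds; no Literature fact is declared or used.  Custodian versions as in `WedgeHankelSiegelIdeal` (1/3); the dictionary («infinite Hankel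
matrix of finite rank», «linear complexity of an infinite sequence») is QUOTED in docstrings, never asserted — every statement is about the finite windows `[0, N]`, all `N` at once.

WHAT IS IN THE TREE.  N18 (`WedgeHankelRecurrenceModule`): `recSpace`, `mem_recSpace_iff`, `hkFun`, `finrank_recSpace_self` (`dim Rec^N_R(q) = 1` for `2R ≤ N + 1`), `mem_degreeLT_succ_iff`,
`recSpace_le_degreeLT`; N32 (`WedgeHankelRecurrenceDual`): `dualSeq`, `mem_recSpace_dualSeq`, `exists_dualSeq_of_mem_recSpace`, `dualSeq_unique`; N40 (`WedgeHankelRecurrenceLevel`):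
`rank_half_le_level_succ` (`R^N ≤ R^{N+1}`), `rank_half_level_succ_dichotomy` (affine class: keep `m` and the rank, or break `m` and step up); N41 (`WedgeHankelRecurrenceExtension`):
`rank_half_succ_of_polar` (a class with a node at infinity always steps up), `exists_monic_mem_recSpace'`; N70 (`WedgeHankelRecurrenceLinearComplexity`):
`rank_half_le_of_mem_setOf_lfsr` (a full-degree recurrence of window `k + 1` forces `R^N ≤ k`).
THIS FILE (namespace `Summit.Ventures.HSemireg.Wedge.HankelOuter` continued; PLAIN on N41 + N40 + N70; 0 definitions):
* §654 `exists_forall_le_of_forall_le` (a bounded `ℕ`-sequence attains its maximum), `recSpace_antitone_level` (`Rec^{N'}_k ≤ Rec^N_k` for `N ≤ N'`), `rank_half_mono` (`N ↦ R^N(q)` is monotone),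
  `rank_half_dualSeq_le_natDegree` ((i) ⇒ (ii): `R^N(dualSeq m a) ≤ deg m`), `forall_hkFun_eq_zero_iff_forall_mem_recSpace` ((iii) ⟺ `m ∈ Rec^N_{deg m}(q)` for all `N`),
  **`natDegree_eq_and_forall_mem_recSpace_of_rank_half_eq`** (THE PERSISTENCE LEMMA: if `R^N(q) = r` for all `N ≥ N₁` with `2r ≤ N₁`, every non-zero `m ∈ Rec^{N₁}_r(q)` has full degree `r`
  — no node at infinity survives — and lies in `Rec^N_r(q)` for EVERY `N`), **`exists_dualSeq_eq_of_forall_rank_half_le`** ((ii) ⇒ (i)), **`exists_eventually_rank_half_eq_natDegree`**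
  (the eventual rank is the degree of a monic recurrence valid at every shift), **`forall_rank_half_le_iff_exists_dualSeq`** (KRONECKER: (ii) ⟺ (i)),
  **`forall_rank_half_le_iff_exists_recurrence`** ((ii) ⟺ (iii)).
Nothing Ext-side.  New names only.
-/

open Module Polynomial
open scoped Matrix Polynomial

namespace Summit.Ventures.HSemireg.Wedge.HankelOuter

open Summit.Ventures.HSemireg.Wedge Summit.Ventures.HSemireg.Wedge.Hankel

variable (K : Type*) [Field K]

/-! ## §654. Kronecker's theorem: bounded Hankel ranks ⟺ rational ⟺ linearly recurrent -/

/-- a sequence of naturals bounded by `d` attains its maximum. -/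
theorem exists_forall_le_of_forall_le (R : ℕ → ℕ) {d : ℕ} (h : ∀ N, R N ≤ d) : ∃ N₀, ∀ N, R N ≤ R N₀ := by
  induction d with
  | zero => exact ⟨0, fun N => (h N).trans (Nat.zero_le _)⟩
  | succ d ih =>
    by_cases hex : ∃ N, R N = d + 1
    · obtain ⟨N₀, hN₀⟩ := hex
      exact ⟨N₀, fun N => hN₀ ▸ h N⟩
    · exact ih fun N => Nat.lt_succ_iff.mp (lt_of_le_of_ne (h N) fun hN => hex ⟨N, hN⟩)

/-- **recurrence spaces shrink as the window grows: `Rec^{N'}_k(q) ≤ Rec^N_k(q)` for `N ≤ N'`** (more shifts are constrained). -/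
theorem recSpace_antitone_level {N N' : ℕ} (h : N ≤ N') (q : ℕ → K) (k : ℕ) : recSpace K N' q k ≤ recSpace K N q k := fun p hp => by
  rw [mem_recSpace_iff] at hp ⊢
  exact ⟨hp.1, fun s hs => hp.2 s (by omega)⟩

/-- **the middle rank `N ↦ R^N(q)` is monotone** (N40's one-step bound iterated). -/
theorem rank_half_mono (q : ℕ → K) : Monotone fun N => (hankel1 K N (N / 2) q).rank :=
  monotone_nat_of_le_succ fun N => rank_half_le_level_succ K (N := N) q

/-- **(i) ⇒ (ii): `R^N(dualSeq m a) ≤ deg m` for every `N`** (`m` monic, any `a`): `m` itself is a full-degree recurrence of every window (N32 + N70). -/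
theorem rank_half_dualSeq_le_natDegree {m : K[X]} (hm : m.Monic) (a : K[X]) (N : ℕ) : (hankel1 K N (N / 2) (dualSeq K m a)).rank ≤ m.natDegree :=
  rank_half_le_of_mem_setOf_lfsr K ⟨m, mem_recSpace_dualSeq K hm a, hm.ne_zero, rfl⟩

/-- (iii) spelled out: **`⟪m, q⟫_s = 0` for every shift `s` iff `m ∈ Rec^N_{deg m}(q)` for every level `N`.** -/
theorem forall_hkFun_eq_zero_iff_forall_mem_recSpace {q : ℕ → K} {m : K[X]} : (∀ s, hkFun K q s m = 0) ↔ ∀ N, m ∈ recSpace K N q m.natDegree := by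
  constructor
  · intro h N
    exact (mem_recSpace_iff K).mpr ⟨(mem_degreeLT_succ_iff K).mpr le_rfl, fun s _ => h s⟩
  · intro h s
    exact ((mem_recSpace_iff K).mp (h (s + m.natDegree))).2 s le_rfl

/-- **THE PERSISTENCE LEMMA: if `R^N(q) = r` for every `N ≥ N₁` (`2r ≤ N₁`), then every non-zero `m ∈ Rec^{N₁}_r(q)` has FULL degree `r` and lies in `Rec^N_r(q)` for EVERY `N`.**  A generator of
degree `< r` would be a node at infinity, which steps the rank up at the next level (N41); a full-degree generator that breaks at some level would step the rank up too (N40's dichotomy);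
downwards the recurrence spaces only grow. -/
theorem natDegree_eq_and_forall_mem_recSpace_of_rank_half_eq {q : ℕ → K} {r N₁ : ℕ} (hconst : ∀ N, N₁ ≤ N → (hankel1 K N (N / 2) q).rank = r) (h2 : r + r ≤ N₁) {m : K[X]}
    (hm : m ∈ recSpace K N₁ q r) (hm0 : m ≠ 0) : m.natDegree = r ∧ ∀ N, m ∈ recSpace K N q r := by
  have hdeg_le : m.natDegree ≤ r := (mem_degreeLT_succ_iff K).mp (recSpace_le_degreeLT K q r hm)
  have hdeg : m.natDegree = r := by
    by_contra hne
    obtain ⟨e, he⟩ : ∃ e, r = m.natDegree + e := Nat.exists_eq_add_of_le hdeg_le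
    have he1 : 1 ≤ e := by omega
    have hr₁ : (hankel1 K N₁ (N₁ / 2) q).rank = m.natDegree + e := by rw [← he]; exact hconst N₁ le_rfl
    have hm₁ : m ∈ recSpace K N₁ q (m.natDegree + e) := by rw [← he]; exact hm
    have hstep := (rank_half_succ_of_polar K (N := N₁) he1 hm0 rfl hr₁ hm₁ (by omega)).1
    have hnext := hconst (N₁ + 1) (Nat.le_succ _)
    omega
  refine ⟨hdeg, ?_⟩
  have hup : ∀ j, m ∈ recSpace K (N₁ + j) q r := by
    intro j
    induction j with
    | zero => exact hm
    | succ j ih =>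
      rcases rank_half_level_succ_dichotomy K (N := N₁ + j) (hconst _ (Nat.le_add_right _ _)) ih hm0 hdeg (by omega) with ⟨hmem, -⟩ | ⟨-, hrank⟩
      · exact hmem
      · have hnext := hconst (N₁ + j + 1) (by omega)
        omega
  intro N
  rcases le_or_gt N₁ N with hle | hlt
  · obtain ⟨j, rfl⟩ := Nat.exists_eq_add_of_le hle
    exact hup j
  · exact recSpace_antitone_level K hlt.le q r hm

/-- **THE EVENTUAL RANK IS THE DEGREE OF A RECURRENCE VALID AT EVERY SHIFT**: if `R^N(q) ≤ d` for all `N`, there are a level `N₁` and a MONIC `m` of degree `≤ d` with `R^N(q) = deg m` for every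
`N ≥ N₁` and `m ∈ Rec^N_{deg m}(q)` for every `N` («the linear complexity of the infinite sequence is `lim R^N(q)`»). -/
theorem exists_eventually_rank_half_eq_natDegree {q : ℕ → K} {d : ℕ} (hbound : ∀ N, (hankel1 K N (N / 2) q).rank ≤ d) :
    ∃ N₁ : ℕ, ∃ m : K[X], m.Monic ∧ m.natDegree ≤ d ∧ (∀ N, N₁ ≤ N → (hankel1 K N (N / 2) q).rank = m.natDegree) ∧ ∀ N, m ∈ recSpace K N q m.natDegree := by
  obtain ⟨N₀, hN₀⟩ := exists_forall_le_of_forall_le (fun N => (hankel1 K N (N / 2) q).rank) hbound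
  set r := (hankel1 K N₀ (N₀ / 2) q).rank with hr
  have hconst : ∀ N, N₀ + (r + r) ≤ N → (hankel1 K N (N / 2) q).rank = r := fun N hN => le_antisymm (hN₀ N) (rank_half_mono K q (show N₀ ≤ N by omega))
  haveI := finiteDimensional_recSpace K (N := N₀ + (r + r)) q r
  have h1 : finrank K (recSpace K (N₀ + (r + r)) q r) = 1 := finrank_recSpace_self K (hconst _ le_rfl) (by omega)
  obtain ⟨x, hx0⟩ := finrank_pos_iff_exists_ne_zero.mp (show 0 < finrank K (recSpace K (N₀ + (r + r)) q r) by omega)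
  have hx0' : (x : K[X]) ≠ 0 := fun h => hx0 (Subtype.ext h)
  obtain ⟨m, hmo, -, hm, -⟩ := exists_monic_mem_recSpace' K x.2 hx0'
  obtain ⟨hdeg, hall⟩ := natDegree_eq_and_forall_mem_recSpace_of_rank_half_eq K hconst (by omega) hm hmo.ne_zero
  refine ⟨N₀ + (r + r), m, hmo, hdeg ▸ hbound N₀, fun N hN => hdeg ▸ hconst N hN, fun N => hdeg ▸ hall N⟩

/-- **(ii) ⇒ (i): BOUNDED MIDDLE RANKS ⇒ A DUAL CLASS.** If `R^N(q) ≤ d` for every `N` then `q = dualSeq m a` for a monic `m` of degree `≤ d` and `deg a < deg m` (the numerator is read off the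
first `deg m` values and is the same at every level by N32's uniqueness). -/
theorem exists_dualSeq_eq_of_forall_rank_half_le {q : ℕ → K} {d : ℕ} (hbound : ∀ N, (hankel1 K N (N / 2) q).rank ≤ d) :
    ∃ m : K[X], m.Monic ∧ m.natDegree ≤ d ∧ ∃ a ∈ Polynomial.degreeLT K m.natDegree, q = dualSeq K m a := by
  obtain ⟨-, m, hmo, hmd, -, hall⟩ := exists_eventually_rank_half_eq_natDegree K hbound
  obtain ⟨a, ha, hqa⟩ := exists_dualSeq_of_mem_recSpace K hmo (hall m.natDegree)
  refine ⟨m, hmo, hmd, a, ha, funext fun j => ?_⟩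
  obtain ⟨a', ha', hqa'⟩ := exists_dualSeq_of_mem_recSpace K hmo (hall (max m.natDegree j))
  have haa' : a = a' :=
    dualSeq_unique K hmo (N := m.natDegree) (Nat.le_succ _) ha ha' fun i hi => by rw [← hqa i hi, hqa' i (hi.trans (le_max_left _ _))]
  rw [haa']
  exact hqa' j (le_max_right _ _)

/-- **KRONECKER'S THEOREM (1881): `R^N(q) ≤ d` for every `N` iff `q` is the coefficient sequence of a rational function `a/m` with `m` monic of degree `≤ d` and `deg a < deg m`**
(«the infinite Hankel matrix of `q` has rank `≤ d` iff `q` is rational of denominator degree `≤ d`»). Any field. -/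
theorem forall_rank_half_le_iff_exists_dualSeq (q : ℕ → K) (d : ℕ) :
    (∀ N, (hankel1 K N (N / 2) q).rank ≤ d) ↔ ∃ m : K[X], m.Monic ∧ m.natDegree ≤ d ∧ ∃ a ∈ Polynomial.degreeLT K m.natDegree, q = dualSeq K m a := by
  refine ⟨exists_dualSeq_eq_of_forall_rank_half_le K, ?_⟩
  rintro ⟨m, hmo, hmd, a, -, rfl⟩ N
  exact (rank_half_dualSeq_le_natDegree K hmo a N).trans hmd

/-- **KRONECKER, RECURRENCE FORM: `R^N(q) ≤ d` for every `N` iff `q` satisfies one MONIC linear recurrence of order `≤ d` at every shift** (`Σ_i m_i q_{i+s} = 0` for all `s`). Any field. -/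
theorem forall_rank_half_le_iff_exists_recurrence (q : ℕ → K) (d : ℕ) :
    (∀ N, (hankel1 K N (N / 2) q).rank ≤ d) ↔ ∃ m : K[X], m.Monic ∧ m.natDegree ≤ d ∧ ∀ s, hkFun K q s m = 0 := by
  constructor
  · intro h
    obtain ⟨-, m, hmo, hmd, -, hall⟩ := exists_eventually_rank_half_eq_natDegree K h
    exact ⟨m, hmo, hmd, (forall_hkFun_eq_zero_iff_forall_mem_recSpace K).mpr hall⟩
  · rintro ⟨m, hmo, hmd, hrec⟩ N
    exact (rank_half_le_of_mem_setOf_lfsr K ⟨m, (forall_hkFun_eq_zero_iff_forall_mem_recSpace K).mp hrec N, hmo.ne_zero, rfl⟩).trans hmd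

end Summit.Ventures.HSemireg.Wedge.HankelOuter
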